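import Literature.AnabelianGeometry.AbsoluteAnabelian.AbsTopIII.FrobeniusPictureMLFTelecore

/-!
# [AbsTopIII] Corollary 3.6 (iii) second clause and (v) last two sentences — the LITERAL
# Def 3.5 (ii)/(v) compatibility statements

S. Mochizuki, *Topics in Absolute Anabelian Geometry III*, Cor. 3.6 pp. 78–80 of the kurims manuscript
(`paper:url-5493eb38cbb7`; bib key `MochizukiAbsTopIII2015`), read on the page (p. 80); Def. 3.5 (ii)
("compatible" families of homotopies: contained in one family) and (v) (compatibility of an
equivalence of diagrams with families of homotopies), pp. 75–76.  Block W2-B1 of the abc-iut cell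
(seat abc-iut-L4-t5); closes the two "NOT typed literally" items recorded in the module docstring of
`FrobeniusPictureMLF.lean` (node `AbsTopIII:Cor3.6(iii)`, `(v)`):

* (iii), second clause: the family of homotopies of `𝔖_log` "is compatible with the families of
  homotopies that constitute the core and telecore structures of (i), (ii)";
* (v), third sentence: "the self-equivalences in these nexus-classes are compatible with the
  families of homotopies that constitute the cores and observable of (i), (iii)"; fourth sentence:
  "these self-equivalences also extend naturally [cf. the technique of extension applied in
  Definition 3.5, (vi)] to the diagram of categories [cf. Definition 3.5, (iv), (a)] that constitutes
  the telecore of (ii), in a fashion that is compatible with both the family of homotopies that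
  constitutes this telecore structure [cf. Definition 3.5, (iv), (b)] and the contact structure `ℋ_An`
  of (ii)".

## How the statements are typed

The families of (i), (ii), (iii) live on DIFFERENT presentations (`𝒟_{≤3} = 𝒟_{≤2} ∪ {𝒩}` for
`𝔖_log`, `𝒟_{≤n-1} ∪ {core vertex}` for the cores, `𝒟_An = 𝒟_{≤5} ∪ {φ_⋏}` for the telecore), all of
which are sub-diagrams of `𝒟` or of `𝒟_An`.  Def. 3.5 (ii) defines compatibility of families on ONE
diagram ("there is a family containing them all"); read across an embedding of oriented graphs
`F : Γ⃗' ↪ Γ⃗` along which the categories and functors agree, this is `HomotopyFamily.CompatibleAlong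
F H K`: every boundary pair `([γ₁],[γ₂])` of `H` maps to a boundary pair of `K` carrying the same
homotopy (stated with `HEq`, the path functors agreeing definitionally pair by pair).  The
embeddings are `embLog` (`𝒟_{≤3} ↪ 𝒟`), `embCore4/5/6` (`𝒟_{≤n} ∪ {core} ↪ 𝒟`), `embLogTele`
(`𝒟_{≤3} ↪ 𝒟_An`).  Then:

* `LogObsCompatCoresStmt` — ONE family `K` on `𝒟` contains the `𝔖_log` family (generated by the
  type-(1)/(2) pairs with `ι_{log,⋎}`, `ι_×` as homotopies — the typed (iii) of `ObservableLogStmt`)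
  and, for `n = 4, 5, 6`, a family making `(𝒟_{≤n}, core vertex)` a core (the typed (i)): the
  "core" half of (iii)'s second clause (`RealisesCoresAndLogObs K`);
* `LogObsCompatTelecoreStmt τ` — over a telecore `𝔗_An` of the printed shape (the typed (ii),
  `IsTelecoreAn`), ONE family on `𝒟_An` contains the telecore family `𝒥` and the `𝔖_log` family: the
  "telecore" half of (iii)'s second clause (by (iv), `ℋ_An` can NOT be added: `TelecoreIncompatibleStmt`);
* `ShiftCompatStmt` — (v), third sentence: the `ℤ`-action `Φ` by nexus-classes of self-equivalences
  (the typed `ShiftStmt`, factored as `IsShiftAction Φ`) is compatible in the sense of Def. 3.5 (v)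
  (`OneMorphism.CompatibleWith`, abc-iut-L4-t2) with a family `K` realising the cores and `𝔖_log`;
* `ShiftTelecoreCompatStmt τ` — (v), fourth sentence: the `Φ_m` extend to self-equivalences `Ψ_m` of
  `𝒟_An` (identity at `Anab`, agreeing with `Φ_m` on `𝒟_{≤5}`) compatible (Def. 3.5 (v)) with the
  telecore family `𝒥` and with the contact structure `ℋ_An` (the typed (ii), factored as
  `IsContactAn τ T Hc`).

The factorisations are definitional: `shiftStmt_iff`, `telecoreStmt_iff`, `observableLogStmt_iff`.
HONEST FRAMING: statements only (typed, NOT proved here; the printed proofs — "immediate from the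
definitions", p. 81, and the core/`IotaOverGaloisStmt` mechanism — are the discharge targets);
nothing in this file bears on [IUTchIII] Cor. 3.12 or takes a side.
-/

namespace Literature.AnabelianGeometry.AbsoluteAnabelian

open _root_.CategoryTheory _root_.Quiver

universe v u w w'

/-! ### Def. 3.5 (ii) compatibility read across an embedding of oriented graphs -/

namespace DiagramOfCategories

/-- **Def. 3.5 (ii) "compatible", across an embedding of oriented graphs** `F : Γ⃗' → Γ⃗` (along
which the diagrams `𝒟'`, `𝒟` agree): the family `H` on `𝒟'` is compatible with the family `K` on `𝒟`
if every boundary pair `([γ₁],[γ₂]) ∈ E_H` maps to a boundary pair `(F[γ₁], F[γ₂]) ∈ E_K` with the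
same homotopy `ζ` — i.e. "`E_{H} ⊆ E_K` and `ζ^H_ϖ = ζ^K_ϖ`" of Def. 3.5 (ii) for a family and its
image (the equality of homotopies is heterogeneous: the path functors `𝒟'_{[γ]}` and `𝒟_{F[γ]}`
agree for each explicit path, not uniformly in the path variable).
[cite: MochizukiAbsTopIII2015, Definition 3.5 (ii) p.75] -/
def HomotopyFamily.CompatibleAlong {V : Type w} [Quiver.{v} V] {V' : Type w'} [Quiver.{v} V']
    {D' : DiagramOfCategories.{v, u, w'} V'} {D : DiagramOfCategories.{v, u, w} V}
    (F : V' ⥤q V) (H : D'.HomotopyFamily) (K : D.HomotopyFamily) : Prop :=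
  ∀ ⦃a b : V'⦄ (p q : Path a b) (h : H.E p q),
    ∃ h' : K.E (F.mapPath p) (F.mapPath q), HEq (H.η h) (K.η h')

end DiagramOfCategories

namespace LogFrobeniusData

open DiagramOfCategories

variable (Δ : LogFrobeniusData.{u})

/-! ### The embeddings of the presentations into `𝒟` and `𝒟_An` -/

/-- `𝒟_{≤3}` (presented as `𝒟_{≤2} ∪ {𝒩}`, `sub3`) `↪ 𝒟`: base vertices to themselves, the observation
vertex to the row-3 vertex `𝒩`, the observation edges `λ^×, λ^{×pf}` to the edges `□ → 𝒩` of `Γ⃗_𝒟`.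
[cite: MochizukiAbsTopIII2015, Corollary 3.6 (iii) p.80] -/
def embLog : logObsShape.{u}.Vertex ⥤q LFVertex where
  obj a := match a with
    | ExtVertex.base a => a.1
    | ExtVertex.obs => LFVertex.third
  map {a b} e := match a, b, e with
    | ExtVertex.base _, ExtVertex.base _, e => e
    | ExtVertex.base ⟨.nexus, _⟩, ExtVertex.obs, i => i
    | ExtVertex.base ⟨.row1 _, _⟩, ExtVertex.obs, i => PEmpty.elim i
    | ExtVertex.base ⟨.third, _⟩, ExtVertex.obs, i => PEmpty.elim i
    | ExtVertex.base ⟨.fourth, _⟩, ExtVertex.obs, i => PEmpty.elim i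
    | ExtVertex.base ⟨.fifth, _⟩, ExtVertex.obs, i => PEmpty.elim i
    | ExtVertex.base ⟨.sixth, _⟩, ExtVertex.obs, i => PEmpty.elim i
    | ExtVertex.obs, ExtVertex.base _, j => PEmpty.elim j
    | ExtVertex.obs, ExtVertex.obs, e => PEmpty.elim e

/-- `𝒟_{≤4}` (presented as `𝒟_{≤3} ∪ {ℰ}`) `↪ 𝒟`: the observation vertex to the row-4 vertex `ℰ`, the
observation edge to `𝒩 → ℰ`. [cite: MochizukiAbsTopIII2015, Corollary 3.6 (i) p.79] -/
def embCore4 : coreShape4.{u}.Vertex ⥤q LFVertex where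
  obj a := match a with
    | ExtVertex.base a => a.1
    | ExtVertex.obs => LFVertex.fourth
  map {a b} e := match a, b, e with
    | ExtVertex.base _, ExtVertex.base _, e => e
    | ExtVertex.base ⟨.third, _⟩, ExtVertex.obs, _ => LFVertex.edge34
    | ExtVertex.base ⟨.row1 _, _⟩, ExtVertex.obs, i => PEmpty.elim i
    | ExtVertex.base ⟨.nexus, _⟩, ExtVertex.obs, i => PEmpty.elim i
    | ExtVertex.base ⟨.fourth, _⟩, ExtVertex.obs, i => PEmpty.elim i
    | ExtVertex.base ⟨.fifth, _⟩, ExtVertex.obs, i => PEmpty.elim i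
    | ExtVertex.base ⟨.sixth, _⟩, ExtVertex.obs, i => PEmpty.elim i
    | ExtVertex.obs, ExtVertex.base _, j => PEmpty.elim j
    | ExtVertex.obs, ExtVertex.obs, e => PEmpty.elim e

/-- `𝒟_{≤5}` (presented as `𝒟_{≤4} ∪ {Anab}`) `↪ 𝒟`: the observation vertex to the row-5 vertex
`Anab`, the observation edge to `κ_An : ℰ → Anab`. [cite: MochizukiAbsTopIII2015, Corollary 3.6 (i) p.79] -/
def embCore5 : coreShape5.{u}.Vertex ⥤q LFVertex where
  obj a := match a with
    | ExtVertex.base a => a.1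
    | ExtVertex.obs => LFVertex.fifth
  map {a b} e := match a, b, e with
    | ExtVertex.base _, ExtVertex.base _, e => e
    | ExtVertex.base ⟨.fourth, _⟩, ExtVertex.obs, _ => LFVertex.edge45
    | ExtVertex.base ⟨.row1 _, _⟩, ExtVertex.obs, i => PEmpty.elim i
    | ExtVertex.base ⟨.nexus, _⟩, ExtVertex.obs, i => PEmpty.elim i
    | ExtVertex.base ⟨.third, _⟩, ExtVertex.obs, i => PEmpty.elim i
    | ExtVertex.base ⟨.fifth, _⟩, ExtVertex.obs, i => PEmpty.elim i
    | ExtVertex.base ⟨.sixth, _⟩, ExtVertex.obs, i => PEmpty.elim i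
    | ExtVertex.obs, ExtVertex.base _, j => PEmpty.elim j
    | ExtVertex.obs, ExtVertex.obs, e => PEmpty.elim e

/-- `𝒟_{≤6} = 𝒟` (presented as `𝒟_{≤5} ∪ {ℰ}`) `↪ 𝒟`: the observation vertex to the row-6 vertex `ℰ`,
the observation edge to the projection `Anab → ℰ`. [cite: MochizukiAbsTopIII2015, Corollary 3.6 (i) p.79] -/
def embCore6 : coreShape6.{u}.Vertex ⥤q LFVertex where
  obj a := match a with
    | ExtVertex.base a => a.1
    | ExtVertex.obs => LFVertex.sixth
  map {a b} e := match a, b, e with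
    | ExtVertex.base _, ExtVertex.base _, e => e
    | ExtVertex.base ⟨.fifth, _⟩, ExtVertex.obs, _ => LFVertex.edge56
    | ExtVertex.base ⟨.row1 _, _⟩, ExtVertex.obs, i => PEmpty.elim i
    | ExtVertex.base ⟨.nexus, _⟩, ExtVertex.obs, i => PEmpty.elim i
    | ExtVertex.base ⟨.third, _⟩, ExtVertex.obs, i => PEmpty.elim i
    | ExtVertex.base ⟨.fourth, _⟩, ExtVertex.obs, i => PEmpty.elim i
    | ExtVertex.base ⟨.sixth, _⟩, ExtVertex.obs, i => PEmpty.elim i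
    | ExtVertex.obs, ExtVertex.base _, j => PEmpty.elim j
    | ExtVertex.obs, ExtVertex.obs, e => PEmpty.elim e

/-- A vertex of the first two rows lies in the first four rows. [folklore] -/
private theorem row_le_four_of_le_two {a : LFVertex} (h : a ∈ {a : LFVertex | a.row ≤ 2}) :
    a ∈ {a : LFVertex | a.row ≤ 4} :=
  le_trans (show a.row ≤ 2 from h) (by decide)

/-- `𝒟_{≤3}` (presented as `𝒟_{≤2} ∪ {𝒩}`) `↪ 𝒟_An` (the telecore diagram with telecore edges `J`):
base vertices to base vertices, the observation vertex `𝒩` to the base vertex `𝒩` of `𝒟_{≤4}`.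
[cite: MochizukiAbsTopIII2015, Corollary 3.6 (iii) p.80] -/
def embLogTele (J : SubVertex {a : LFVertex | a.row ≤ 4} → Type u) :
    logObsShape.{u}.Vertex ⥤q (teleShape J).Vertex where
  obj a := match a with
    | ExtVertex.base a => (teleShape J).base ⟨a.1, row_le_four_of_le_two a.2⟩
    | ExtVertex.obs => (teleShape J).base (vx 4 .third (by decide))
  map {a b} e := match a, b, e with
    | ExtVertex.base _, ExtVertex.base _, e => e
    | ExtVertex.base ⟨.nexus, _⟩, ExtVertex.obs, i => i
    | ExtVertex.base ⟨.row1 _, _⟩, ExtVertex.obs, i => PEmpty.elim i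
    | ExtVertex.base ⟨.third, _⟩, ExtVertex.obs, i => PEmpty.elim i
    | ExtVertex.base ⟨.fourth, _⟩, ExtVertex.obs, i => PEmpty.elim i
    | ExtVertex.base ⟨.fifth, _⟩, ExtVertex.obs, i => PEmpty.elim i
    | ExtVertex.base ⟨.sixth, _⟩, ExtVertex.obs, i => PEmpty.elim i
    | ExtVertex.obs, ExtVertex.base _, j => PEmpty.elim j
    | ExtVertex.obs, ExtVertex.obs, e => PEmpty.elim e

/-! ### Factorisations of the typed (i), (ii), (iii), (v) -/

/-- The family `H` on `𝒟_{≤3}` IS (the family of) the observable `𝔖_log`: generated by the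
type-(1)/(2) pairs, boundary paths ending at `𝒩`, with `ι_{log,⋎}`, `ι_×` as the homotopies on the
generators (the body of `ObservableLogStmt`). [cite: MochizukiAbsTopIII2015, Corollary 3.6 (iii) p.80] -/
def IsLogObservableFamily (H : Δ.sub3.HomotopyFamily) : Prop :=
  HomotopyFamily.IsGeneratedBy _ H Δ.LogGen ∧
    (∀ ⦃a b : logObsShape.{u}.Vertex⦄ ⦃p q : Path a b⦄, H.E p q → b = logObsShape.{u}.obs) ∧
    Δ.LogPinned H

/-- `ObservableLogStmt` is "some family is the `𝔖_log` family" (definitional factorisation).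
[cite: MochizukiAbsTopIII2015, Corollary 3.6 (iii) p.80] -/
theorem observableLogStmt_iff : Δ.ObservableLogStmt ↔ ∃ H, Δ.IsLogObservableFamily H := Iff.rfl

/-- **A family `K` on `𝒟` realising the cores of (i) and the observable of (iii)**: `K` contains
(Def. 3.5 (ii), along the embeddings) an `𝔖_log` family on `𝒟_{≤3}` and, for `n = 4, 5, 6`, a family
making `(𝒟_{≤n}, core vertex)` a core. [cite: MochizukiAbsTopIII2015, Corollary 3.6 (iii) p.80] -/
def RealisesCoresAndLogObs (K : Δ.diagram.HomotopyFamily) : Prop :=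
  (∃ H : Δ.sub3.HomotopyFamily, Δ.IsLogObservableFamily H ∧ H.CompatibleAlong embLog K) ∧
  (∃ H hH, (Δ.coreObs4 H hH).IsCore ∧ H.CompatibleAlong embCore4 K) ∧
  (∃ H hH, (Δ.coreObs5 H hH).IsCore ∧ H.CompatibleAlong embCore5 K) ∧
  (∃ H hH, (Δ.coreObs6 H hH).IsCore ∧ H.CompatibleAlong embCore6 K)

/-- `Φ : ℤ → (self-equivalences of 𝒟)` IS the `ℤ`-action of (v): nexus-classes translating the first
row by `m`, with `Φ_0 ≅ id` and `Φ_m ∘ Φ_{m'} ≅ Φ_{m+m'}` (the body of `ShiftStmt`).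
[cite: MochizukiAbsTopIII2015, Corollary 3.6 (v) p.80] -/
def IsShiftAction (Φ : ℤ → Δ.diagram.SelfEquivalence) : Prop :=
  (∀ m, (Φ m).IsNexusClass .nexus {a : LFVertex | a.row = 1}) ∧
    (∀ m n : ℤ, (Φ m).graphMap.obj (.row1 n) = .row1 (n + m)) ∧
    (∃ h₀ : (Φ 0).graphMap = 𝟭q LFVertex,
      (h₀ ▸ (Φ 0).hom).Isomorphic (OneMorphism.id Δ.diagram)) ∧
    (∀ m m' : ℤ, ∃ h : (Φ m).graphMap ⋙q (Φ m').graphMap = (Φ (m + m')).graphMap,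
      (h ▸ ((Φ m).hom.comp (Φ m').hom)).Isomorphic (Φ (m + m')).hom)

/-- `ShiftStmt` is "some `Φ` is the `ℤ`-action" (definitional factorisation).
[cite: MochizukiAbsTopIII2015, Corollary 3.6 (v) p.80] -/
theorem shiftStmt_iff : Δ.ShiftStmt ↔ ∃ Φ, Δ.IsShiftAction Φ := Iff.rfl

/-- `Hc` IS the contact structure `ℋ_An` of (ii) on the telecore `T`: compatible with `𝒥`, generated
by `ContactGen`, with the printed homotopies on the generators (`η_{□⋎} = e⁻¹`, `η_□ = η_An`,
`η_⋎ = η₁`) — the body of the contact half of `TelecoreStmt`.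
[cite: MochizukiAbsTopIII2015, Corollary 3.6 (ii) p.80] -/
def IsContactAn (τ : Δ.TelecoreData) {H : Δ.core5Diagram.HomotopyFamily}
    {hH : ∀ ⦃a b : coreShape5.{u}.Vertex⦄ ⦃p q : Path a b⦄, H.E p q → b = coreShape5.{u}.obs}
    {hc : (Δ.coreObs5 H hH).IsCore} (T : (Δ.sub 4).Telecore (Δ.coreObs5 H hH) hc)
    (Hc : (Δ.teleDiagram T.J T.telMap).HomotopyFamily) : Prop :=
  Telecore.IsContactStructure _ T Hc ∧ HomotopyFamily.IsGeneratedBy _ Hc ContactGen ∧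
    (∀ (n : ℤ) (j : T.J (vx 4 .nexus (by decide)))
        (jn : T.J (vx 4 (.row1 n) (by simp [LFVertex.row])))
        (h : Hc.E (pathPhiNexus j) (pathPhiId n jn)) (a : Δ.A)
        (e₁ : ((Δ.teleDiagram T.J T.telMap).pathFunctor (pathPhiNexus j)).obj a = Δ.φ.obj a)
        (e₂ : ((Δ.teleDiagram T.J T.telMap).pathFunctor (pathPhiId n jn)).obj a =
          Δ.toNexus.obj (τ.φ₁.obj a)),
        (Hc.η h).app a = eqToHom e₁ ≫ τ.e.inv.app a ≫ eqToHom e₂.symm) ∧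
    (∀ (j : T.J (vx 4 .nexus (by decide))) (h : Hc.E (pathBetaNexus j) Path.nil) (x : Δ.X)
        (e₁ : ((Δ.teleDiagram T.J T.telMap).pathFunctor (pathBetaNexus j)).obj x =
          Δ.φ.obj (Δ.κ.obj (Δ.XtoE.obj x)))
        (e₂ : ((Δ.teleDiagram T.J T.telMap).pathFunctor
          (Path.nil : Path (tvNexus T.J) (tvNexus T.J))).obj x = x),
        (Hc.η h).app x = eqToHom e₁ ≫ Δ.η.hom.app x ≫ eqToHom e₂.symm) ∧
    (∀ (n : ℤ) (jn : T.J (vx 4 (.row1 n) (by simp [LFVertex.row])))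
        (h : Hc.E (pathBetaRow1 n jn) Path.nil) (x : Δ.X₁)
        (e₁ : ((Δ.teleDiagram T.J T.telMap).pathFunctor (pathBetaRow1 n jn)).obj x =
          τ.φ₁.obj (Δ.κ.obj (Δ.XtoE.obj (Δ.toNexus.obj x))))
        (e₂ : ((Δ.teleDiagram T.J T.telMap).pathFunctor
          (Path.nil : Path (tvRow1 T.J n) (tvRow1 T.J n))).obj x = x),
        (Hc.η h).app x = eqToHom e₁ ≫ τ.η₁.hom.app x ≫ eqToHom e₂.symm)

/-- `TelecoreStmt` is "over some core `(𝒟_{≤5}, Anab)`, some telecore of the printed shape carries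
some `ℋ_An`" (definitional factorisation). [cite: MochizukiAbsTopIII2015, Corollary 3.6 (ii) p.80] -/
theorem telecoreStmt_iff (τ : Δ.TelecoreData) :
    Δ.TelecoreStmt τ ↔ ∃ H hH hc, ∃ T : (Δ.sub 4).Telecore (Δ.coreObs5 H hH) hc,
      Δ.IsTelecoreAn τ T ∧ ∃ Hc, Δ.IsContactAn τ T Hc :=
  Iff.rfl

/-! ### Corollary 3.6 (iii), second clause -/

/-- **Cor. 3.6 (iii), second clause — cores**: the family of homotopies of `𝔖_log` "is compatible with
the families of homotopies that constitute the core [...] structures of (i)": ONE family of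
homotopies on `𝒟` contains the `𝔖_log` family and core families for `(𝒟_{≤4}, ℰ)`, `(𝒟_{≤5}, Anab)`,
`(𝒟_{≤6}, ℰ)` (Def. 3.5 (ii) compatibility of the collection, along the graph embeddings).
[cite: MochizukiAbsTopIII2015, Corollary 3.6 (iii) p.80] -/
def LogObsCompatCoresStmt : Prop := ∃ K : Δ.diagram.HomotopyFamily, Δ.RealisesCoresAndLogObs K

/-- **Cor. 3.6 (iii), second clause — telecore**: the family of homotopies of `𝔖_log` "is compatible
with the families of homotopies that constitute the [...] telecore structures of [...] (ii)": over a
telecore `𝔗_An` of the printed shape, ONE family on its diagram `𝒟_An` contains the telecore family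
`𝒥` and (along `𝒟_{≤3} ↪ 𝒟_An`) the `𝔖_log` family.  (By (iv), second sentence, the contact structure
`ℋ_An` cannot be added to this collection: `TelecoreIncompatibleStmt`.)
[cite: MochizukiAbsTopIII2015, Corollary 3.6 (iii) p.80] -/
def LogObsCompatTelecoreStmt (τ : Δ.TelecoreData) : Prop :=
  ∃ H₅ hH₅ hc, ∃ T : (Δ.sub 4).Telecore (Δ.coreObs5 H₅ hH₅) hc, Δ.IsTelecoreAn τ T ∧
    ∃ K : (Δ.teleDiagram T.J T.telMap).HomotopyFamily,
      T.Jfam.CompatibleAlong (𝟭q _) K ∧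
      ∃ H : Δ.sub3.HomotopyFamily, Δ.IsLogObservableFamily H ∧ H.CompatibleAlong (embLogTele T.J) K

/-! ### Corollary 3.6 (v), last two sentences -/

/-- **Cor. 3.6 (v), third sentence**: "the self-equivalences in these nexus-classes are compatible
with the families of homotopies that constitute the cores and observable of (i), (iii)": for the
`ℤ`-action `Φ` of (v) and a family `K` on `𝒟` realising the cores and `𝔖_log`, every `Φ_m` is
compatible with `K` in the sense of Def. 3.5 (v) (`OneMorphism.CompatibleWith`: `Φ_Γ⃗` induces a
bijection of boundary sets and the homotopies commute with the `Φ_e`).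
[cite: MochizukiAbsTopIII2015, Corollary 3.6 (v) p.80] -/
def ShiftCompatStmt : Prop :=
  ∃ (Φ : ℤ → Δ.diagram.SelfEquivalence) (K : Δ.diagram.HomotopyFamily),
    Δ.IsShiftAction Φ ∧ Δ.RealisesCoresAndLogObs K ∧ ∀ m : ℤ, Nonempty ((Φ m).hom.CompatibleWith K K)

/-- **Cor. 3.6 (v), fourth sentence**: "these self-equivalences also extend naturally [cf. the
technique of extension applied in Definition 3.5, (vi)] to the diagram of categories [...] that
constitutes the telecore of (ii), in a fashion that is compatible with both the family of homotopies
that constitutes this telecore structure [...] and the contact structure `ℋ_An` of (ii)": over the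
telecore `𝔗_An` with its `ℋ_An`, each `Φ_m` extends to a self-equivalence `Ψ_m` of `𝒟_An` — the same
map on the vertices and the same functors on the categories of `𝒟_{≤5}`, the identity at `Anab`
(the extension technique of Def. 3.5 (vi)) — with `Ψ_m` compatible (Def. 3.5 (v)) with `𝒥` and with
`ℋ_An`. [cite: MochizukiAbsTopIII2015, Corollary 3.6 (v) p.80] -/
def ShiftTelecoreCompatStmt (τ : Δ.TelecoreData) : Prop :=
  ∃ H₅ hH₅ hc, ∃ (T : (Δ.sub 4).Telecore (Δ.coreObs5 H₅ hH₅) hc)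
    (Hc : (Δ.teleDiagram T.J T.telMap).HomotopyFamily), Δ.IsTelecoreAn τ T ∧ Δ.IsContactAn τ T Hc ∧
    ∃ (Φ : ℤ → Δ.diagram.SelfEquivalence) (Ψ : ℤ → (Δ.teleDiagram T.J T.telMap).SelfEquivalence),
      Δ.IsShiftAction Φ ∧
      (∀ (m : ℤ) (a : SubVertex {a : LFVertex | a.row ≤ 4}),
        ∃ h : (Φ m).graphMap.obj a.1 ∈ {a : LFVertex | a.row ≤ 4},
          (Ψ m).graphMap.obj ((teleShape T.J).base a) = (teleShape T.J).base ⟨_, h⟩ ∧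
          HEq ((Ψ m).hom.app ((teleShape T.J).base a)) ((Φ m).hom.app a.1)) ∧
      (∀ m : ℤ, (Ψ m).graphMap.obj (teleShape T.J).obs = (teleShape T.J).obs ∧
        HEq ((Ψ m).hom.app (teleShape T.J).obs) (𝟭 Δ.A)) ∧
      (∀ m : ℤ, Nonempty ((Ψ m).hom.CompatibleWith T.Jfam T.Jfam) ∧
        Nonempty ((Ψ m).hom.CompatibleWith Hc Hc))

end LogFrobeniusData

end Literature.AnabelianGeometry.AbsoluteAnabelian
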